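import Summits.Ventures.HSemireg.WedgeHankelOuterPairs
import Summits.Ventures.HSemireg.WedgeHankelPairMixingSiegel

/-!
# Venture HSemireg — THE JOINT KERNEL LAW FOR A FAMILY OF CLASSES, ON EVERY SUB-BOX: for classes `w_N(q_c)` (`c ∈ ι`, any finite family) the `k`-forms killed by ALL of them satisfy
# **`dim (Hom(univ,k) ⊓ ⋂_c Kr(univ, w_N q_c, k) ⊓ Sp(pairs ⊆ T)) = C(2|T|, k) − C(|T|, k) · rank [H_k(q_1) | H_k(q_2) | ⋯ ]`** (the block Hankel matrix of the family, th-7's `hank`) for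
# EVERY pair set `T`, every `k`, every field — th-7's THEOREM H is the case `|ι| = 1`, `T = univ`; gen 11's Siegel ideal is the case «all classes»

HONEST FRAMING. Part of the Lean index of the computation cell `pub-hsemireg` (seat p10 gen 23, Sunday typer «UNIFORM-IN-n»).
Finite-dimensional EXTERIOR ALGEBRA over a field ONLY: no variety, no cohomology theory, no sheaf, no Ext group, no semiregularity map;
nothing here says that HC / HC_CM / HC_AV holds; no Literature fact is declared or used.  Custodian versions as in `WedgeHankelSiegelIdeal` (1/3); the dictionary (`w_N(q_c)` = several
classes of the same box; `[H_k(q_1) | ⋯]` = their Hankel matrices side by side) is QUOTED, never asserted.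

WHAT IS IN THE TREE.  th-7 (`WedgeHankelModel`): `JR`/`JRsum`, `hank`, **`finrank_JRsum_w`** (the BLOCK HANKEL LAW `dim JRsum_k(Dm m; w_m ∘ q) = C(m,k) · rank 𝓗^{(m)}_k[q]` for arrays of
sequences); K38 `Kr_w_eq_iInf_Kr_w_shift`; K39 `finrank_inf_iInf_Kr_add_finrank_JR` (joint rank–nullity), `card_Dm_eq_two_mul`; K40 `Kr_univ_inf_Sp_pairs_lt_eq`, `Sp_congr_iff`; K25
`finrank_inf_Sp_pairs_eq_of_card_eq` (swap-stable subspaces), I5 `Pm_mem_Kr_w`, J-leaf `Pm_mem_exteriorPower`.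
THIS FILE (namespace `Summit.Ventures.HSemireg.Wedge.HankelOuter` continued; imports K40 and `WedgeHankelPairMixingSiegel`):
* §397 FAMILIES ON THE SUB-BOX OF THE FIRST `M` PAIRS: `iInf_Kr_w_Dm_eq` (the joint kernel = the joint kernel of all shifted sub-box classes `w_M(σ^j q_c)`), `rank_hank_family_shifts_eq`
  (their block matrix has the rank of `[H_k(q_c)]_c`), **`finrank_iInf_Kr_w_Dm_add`: `dim (Hom(Dm M,k) ⊓ ⋂_c Kr(Dm M, w_N q_c, k)) + C(M,k) · rank (hank K N k q) = C(2M, k)`** (`M ≤ N`),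
  **`finrank_iInf_Kr_w_top_add`** (the full box: THE JOINT KERNEL LAW `dim ⋂_c Kr + C(N,k) · rank [H_k(q_c)]_c = C(2N,k)`).
* §398 EVERY PAIR SET: `Pm_mem_Hom_univ`, `Pm_swapMat_mem_iInf_Kr_w` (the joint kernel is swap-stable), `Hom_iInf_Kr_univ_inf_Sp_pairs_lt_eq`, and
  **`finrank_iInf_Kr_w_inf_Sp_pairs_add`: `dim (Hom(univ,k) ⊓ ⋂_c Kr(univ, w_N q_c, k) ⊓ Sp(pairs ⊆ T)) + C(|T|,k) · rank (hank K N k q) = C(2|T|, k)`** for EVERY `T`.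
READING: on the `k`-forms of ANY sub-box of `M` pairs, a finite family of classes of the box kills a space of codimension `C(M,k)` times the rank of the family's Hankel matrices laid
side by side — th-7's law is uniform in the NUMBER OF CLASSES as well.  Nothing Ext-side.  New names only.
-/

open Module

namespace Summit.Ventures.HSemireg.Wedge.HankelOuter

open Summit.Ventures.HSemireg.Wedge Summit.Ventures.HSemireg.Wedge.Kunneth Summit.Ventures.HSemireg.Wedge.Hankel
  Summit.Ventures.HSemireg.Wedge.BasisFree Summit.Ventures.HSemireg.Wedge.HankelSiegel Summit.Ventures.HSemireg.Wedge.HankelSiegelIdeal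
  Summit.Ventures.HSemireg.Wedge.KunnethKernel Summit.Ventures.HSemireg.Wedge.HankelFrameChange Summit.Ventures.HSemireg.Wedge.Weil
  Summit.Ventures.HSemireg.Wedge.HankelPairMixing

variable (K : Type*) [Field K] {N : ℕ} {ι : Type} [Fintype ι] [DecidableEq ι]

/-! ## §397. Families of classes on the sub-box of the first `M` pairs -/

omit [Fintype ι] [DecidableEq ι] in
/-- **the joint kernel of the family on the sub-box is the joint kernel of all shifted sub-box classes `w_M(σ^j q_c)`** (K38 for each class). -/
theorem iInf_Kr_w_Dm_eq {M : ℕ} (hM : M ≤ N) (k : ℕ) (q : ι → ℕ → K) :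
    Hom K (In N) (Dm N M) k ⊓ ⨅ c, Kr K (Dm N M) (w K N N (q c)) k
      = Hom K (In N) (Dm N M) k ⊓ ⨅ p : ι × Fin (N - M + 1), Kr K (Dm N M) (w K N M ((shift K)^[(p.2 : ℕ)] (q p.1))) k := by
  ext θ
  simp only [Submodule.mem_inf, Submodule.mem_iInf]
  constructor
  · rintro ⟨hθ, h⟩
    refine ⟨hθ, fun p => ?_⟩
    have hc := h p.1
    rw [Kr_w_eq_iInf_Kr_w_shift K hM k (q p.1), Submodule.mem_inf, Submodule.mem_iInf] at hc
    exact hc.2 p.2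
  · rintro ⟨hθ, h⟩
    refine ⟨hθ, fun c => ?_⟩
    rw [Kr_w_eq_iInf_Kr_w_shift K hM k (q c), Submodule.mem_inf, Submodule.mem_iInf]
    exact ⟨hθ, fun j => h (c, j)⟩

omit [DecidableEq ι] in
/-- **the block matrix of all shifted sub-box classes has the rank of `[H_k(q_c)]_c`** (`k ≤ M ≤ N`: both have the columns `(q_c(i+t))_{i ≤ k}`, `t ≤ N − k`). -/
theorem rank_hank_family_shifts_eq {M k : ℕ} (hM : M ≤ N) (hk : k ≤ M) (q : ι → ℕ → K) :
    (hank K M k (fun (_ : Unit) (p : ι × Fin (N - M + 1)) => (shift K)^[(p.2 : ℕ)] (q p.1))).rank = (hank K N k (fun (_ : Unit) (c : ι) => q c)).rank := by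
  have hit : ∀ (c : ι) (l t : ℕ), (shift K)^[l] (q c) t = q c (t + l) := by
    intro c l
    induction l with
    | zero => intro t; rfl
    | succ l ih => intro t; rw [Function.iterate_succ_apply', shift, ih]; ring_nf
  apply le_antisymm
  · have h1 : hank K M k (fun (_ : Unit) (p : ι × Fin (N - M + 1)) => (shift K)^[(p.2 : ℕ)] (q p.1))
        = (hank K N k (fun (_ : Unit) (c : ι) => q c)).submatrix (fun r : Unit × Fin (k + 1) => r)
            (fun s : (ι × Fin (N - M + 1)) × Fin (M + 1 - k) => (s.1.1, (⟨(s.2 : ℕ) + (s.1.2 : ℕ), by omega⟩ : Fin (N + 1 - k)))) := by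
      ext ⟨a, i⟩ ⟨⟨c, j⟩, s⟩
      simp only [hank, hank', Matrix.submatrix_apply, Matrix.of_apply, hit]
      ring_nf
    rw [h1]
    exact Matrix.rank_submatrix_le _ _ _
  · have h2 : hank K N k (fun (_ : Unit) (c : ι) => q c) = (hank K M k (fun (_ : Unit) (p : ι × Fin (N - M + 1)) => (shift K)^[(p.2 : ℕ)] (q p.1))).submatrix
        (fun r : Unit × Fin (k + 1) => r)
        (fun t : ι × Fin (N + 1 - k) => ((t.1, (⟨(t.2 : ℕ) - (M - k), by omega⟩ : Fin (N - M + 1))), (⟨min (t.2 : ℕ) (M - k), by omega⟩ : Fin (M + 1 - k)))) := by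
      ext ⟨a, i⟩ ⟨c, t⟩
      simp only [hank, hank', Matrix.submatrix_apply, Matrix.of_apply, hit]
      congr 1
      omega
    rw [h2]
    exact Matrix.rank_submatrix_le _ _ _

/-- **THE JOINT KERNEL LAW ON THE SUB-BOX OF THE FIRST `M` PAIRS: `dim (Hom(Dm M,k) ⊓ ⋂_c Kr(Dm M, w_N q_c, k)) + C(M,k) · rank [H_k(q_c)]_c = C(2M, k)`** (`M ≤ N`; every finite family,
every `k`, every field). -/
theorem finrank_iInf_Kr_w_Dm_add {M : ℕ} (hM : M ≤ N) (k : ℕ) (q : ι → ℕ → K) :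
    finrank K ↥(Hom K (In N) (Dm N M) k ⊓ ⨅ c, Kr K (Dm N M) (w K N N (q c)) k) + M.choose k * (hank K N k (fun (_ : Unit) (c : ι) => q c)).rank = (M + M).choose k := by
  classical
  have h1 := finrank_inf_iInf_Kr_add_finrank_JR K (Dm N M) k (fun p : ι × Fin (N - M + 1) => w K N M ((shift K)^[(p.2 : ℕ)] (q p.1)))
  rw [← iInf_Kr_w_Dm_eq K hM k q, card_Dm_eq_two_mul M hM, two_mul] at h1
  have hJ : JRsum K (In N) (Dm N M) k (fun (_ : Unit) (p : ι × Fin (N - M + 1)) => w K N M ((shift K)^[(p.2 : ℕ)] (q p.1)))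
      = JR K (In N) (Dm N M) k (fun p : ι × Fin (N - M + 1) => w K N M ((shift K)^[(p.2 : ℕ)] (q p.1))) := by
    rw [JRsum]
    exact iSup_const
  have h2 := finrank_JRsum_w K (n := N) hM k Unit (ι × Fin (N - M + 1)) (fun (_ : Unit) (p : ι × Fin (N - M + 1)) => (shift K)^[(p.2 : ℕ)] (q p.1))
  rw [hJ] at h2
  rw [h2] at h1
  by_cases hk : k ≤ M
  · rw [rank_hank_family_shifts_eq K hM hk q] at h1
    exact h1
  · rw [Nat.choose_eq_zero_of_lt (by omega), zero_mul] at h1 ⊢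
    simpa using h1

/-- **THE JOINT KERNEL LAW (full box): `dim (Hom(univ,k) ⊓ ⋂_c Kr(univ, w_N q_c, k)) + C(N,k) · rank [H_k(q_c)]_c = C(2N, k)`** — th-7's THEOREM H for a finite FAMILY of classes of one box
(every field, `N`, `k`; the family may be empty, one class, or all classes). -/
theorem finrank_iInf_Kr_w_top_add (k : ℕ) (q : ι → ℕ → K) :
    finrank K ↥(Hom K (In N) (Finset.univ : Finset (In N)) k ⊓ ⨅ c, Kr K (Finset.univ : Finset (In N)) (w K N N (q c)) k)
      + N.choose k * (hank K N k (fun (_ : Unit) (c : ι) => q c)).rank = (N + N).choose k := by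
  rw [← Dm_top]
  exact finrank_iInf_Kr_w_Dm_add K le_rfl k q

/-! ## §398. Every pair set -/

/-- pair mixings preserve `Hom(univ, k)` (`= ⋀^k`). -/
theorem Pm_mem_Hom_univ (Q : Matrix (Fin N) (Fin N) K) {k : ℕ} {θ : HT K (In N)} (hθ : θ ∈ Hom K (In N) (Finset.univ : Finset (In N)) k) :
    Pm K Q θ ∈ Hom K (In N) (Finset.univ : Finset (In N)) k := by
  rw [← exteriorPower_eq_Hom_univ] at hθ ⊢
  exact Pm_mem_exteriorPower K Q hθ

omit [Fintype ι] [DecidableEq ι] in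
/-- **the joint kernel of a family is stable under every pair mixing** (in particular under the pair swaps). -/
theorem Pm_mem_Hom_iInf_Kr_w (Q : Matrix (Fin N) (Fin N) K) (q : ι → ℕ → K) {k : ℕ} {θ : HT K (In N)}
    (hθ : θ ∈ Hom K (In N) (Finset.univ : Finset (In N)) k ⊓ ⨅ c, Kr K (Finset.univ : Finset (In N)) (w K N N (q c)) k) :
    Pm K Q θ ∈ Hom K (In N) (Finset.univ : Finset (In N)) k ⊓ ⨅ c, Kr K (Finset.univ : Finset (In N)) (w K N N (q c)) k := by
  rw [Submodule.mem_inf, Submodule.mem_iInf] at hθ ⊢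
  exact ⟨Pm_mem_Hom_univ K Q hθ.1, fun c => Pm_mem_Kr_w K Q (q c) (hθ.2 c)⟩

omit [Fintype ι] [DecidableEq ι] in
/-- the joint kernel on the forms of the first `M` pairs is the joint kernel of the block `Dm M`. -/
theorem Hom_iInf_Kr_univ_inf_Sp_pairs_lt_eq (M : ℕ) (q : ι → ℕ → K) (k : ℕ) :
    Hom K (In N) (Finset.univ : Finset (In N)) k ⊓ (⨅ c, Kr K (Finset.univ : Finset (In N)) (w K N N (q c)) k)
        ⊓ Sp K (fun s : Finset (In N) => ∀ i ∈ s, ((pr i : Fin N) : ℕ) < M)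
      = Hom K (In N) (Dm N M) k ⊓ ⨅ c, Kr K (Dm N M) (w K N N (q c)) k := by
  have hHom : Hom K (In N) (Finset.univ : Finset (In N)) k ⊓ Sp K (fun s : Finset (In N) => ∀ i ∈ s, ((pr i : Fin N) : ℕ) < M) = Hom K (In N) (Dm N M) k := by
    have h := Kr_univ_inf_Sp_pairs_lt_eq K M (0 : HT K (In N)) k
    have h0 : ∀ D : Finset (In N), Kr K D (0 : HT K (In N)) k = Hom K (In N) D k := fun D => by
      ext θ; rw [mem_Kr, mul_zero]; exact ⟨fun h => h.1, fun h => ⟨h, rfl⟩⟩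
    rwa [h0, h0] at h
  ext θ
  simp only [Submodule.mem_inf, Submodule.mem_iInf]
  constructor
  · rintro ⟨⟨hθ, hc⟩, hsp⟩
    have hD : θ ∈ Hom K (In N) (Dm N M) k := by rw [← hHom]; exact ⟨hθ, hsp⟩
    refine ⟨hD, fun c => ?_⟩
    have h := Kr_univ_inf_Sp_pairs_lt_eq K M (w K N N (q c)) k
    rw [← h]
    exact ⟨hc c, hsp⟩
  · rintro ⟨hD, hc⟩
    have h' : θ ∈ Hom K (In N) (Finset.univ : Finset (In N)) k ⊓ Sp K (fun s : Finset (In N) => ∀ i ∈ s, ((pr i : Fin N) : ℕ) < M) := by rw [hHom]; exact hD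
    refine ⟨⟨h'.1, fun c => ?_⟩, h'.2⟩
    have h := Kr_univ_inf_Sp_pairs_lt_eq K M (w K N N (q c)) k
    have hc' := hc c
    rw [← h] at hc'
    exact hc'.1

/-- **THE JOINT KERNEL LAW ON EVERY SUB-BOX: `dim (Hom(univ,k) ⊓ ⋂_c Kr(univ, w_N q_c, k) ⊓ Sp(pairs ⊆ T)) + C(|T|,k) · rank [H_k(q_c)]_c = C(|T| + |T|, k)`** for every pair set
`T`, every finite family, every `k`, every field (K25 moves `T` to the first `|T|` pairs; §397 gives the value there). -/
theorem finrank_iInf_Kr_w_inf_Sp_pairs_add (T : Finset (Fin N)) (k : ℕ) (q : ι → ℕ → K) :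
    finrank K ↥(Hom K (In N) (Finset.univ : Finset (In N)) k ⊓ (⨅ c, Kr K (Finset.univ : Finset (In N)) (w K N N (q c)) k)
        ⊓ Sp K (fun s : Finset (In N) => ∀ i ∈ s, pr i ∈ T))
      + T.card.choose k * (hank K N k (fun (_ : Unit) (c : ι) => q c)).rank = (T.card + T.card).choose k := by
  have hM : T.card ≤ N := by
    have h := Finset.card_le_univ T
    rwa [Fintype.card_fin] at h
  let T₀ : Finset (Fin N) := (Finset.range T.card).attachFin fun m hm => lt_of_lt_of_le (Finset.mem_range.mp hm) hM
  have hT₀ : T.card = T₀.card := by rw [Finset.card_attachFin, Finset.card_range]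
  rw [finrank_inf_Sp_pairs_eq_of_card_eq K (fun a b θ hθ => Pm_mem_Hom_iInf_Kr_w K (swapMat K a b) q hθ) hT₀]
  have hSp : Sp K (fun s : Finset (In N) => ∀ i ∈ s, pr i ∈ T₀) = Sp K (fun s : Finset (In N) => ∀ i ∈ s, ((pr i : Fin N) : ℕ) < T.card) := by
    apply Sp_congr_iff
    intro s
    refine forall₂_congr fun i _ => ?_
    rw [Finset.mem_attachFin, Finset.mem_range]
  rw [hSp, Hom_iInf_Kr_univ_inf_Sp_pairs_lt_eq K T.card q k]
  exact finrank_iInf_Kr_w_Dm_add K hM k q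

/-- subtraction form: **`dim (Hom(univ,k) ⊓ ⋂_c Kr(univ, w_N q_c, k) ⊓ Sp(pairs ⊆ T)) = C(2|T|, k) − C(|T|,k) · rank [H_k(q_c)]_c`.** -/
theorem finrank_iInf_Kr_w_inf_Sp_pairs_eq (T : Finset (Fin N)) (k : ℕ) (q : ι → ℕ → K) :
    finrank K ↥(Hom K (In N) (Finset.univ : Finset (In N)) k ⊓ (⨅ c, Kr K (Finset.univ : Finset (In N)) (w K N N (q c)) k)
        ⊓ Sp K (fun s : Finset (In N) => ∀ i ∈ s, pr i ∈ T))
      = (T.card + T.card).choose k - T.card.choose k * (hank K N k (fun (_ : Unit) (c : ι) => q c)).rank := by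
  have h := finrank_iInf_Kr_w_inf_Sp_pairs_add K T k q
  omega

end Summit.Ventures.HSemireg.Wedge.HankelOuter
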